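import Mathlib
import Summits.Ventures.PercRepro2.Defs
import Summits.Ventures.PercRepro2.Harris
import Summits.Ventures.PercRepro2.Graph
import Summits.Ventures.PercRepro2.Events
import Summits.Ventures.PercRepro2.Independence
import Summits.Ventures.PercRepro2.KTwoKGraph

/-!
# `K_{2,k}`: the three events at a principal pair and their probabilities as products over the
paths (blind cell PercRepro2, mine-a g51)

For `A ⊆ {0, …, k-1}` the event `U A = {x_i ∈ C_r for every i ∈ A}` (`KTwoKGraph.cluster_eq`)
splits along `Q = {h ∈ C_r}`: `Q ∩ U A = Q ∩ R A` (every `A`-path has an open edge) and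
`Qᶜ ∩ U A = Qᶜ ∩ L A` (every `A`-path has exactly its lower edge open) — and on `Qᶜ` the paths are
independent.  Every event needed for the three-event form is an intersection over the paths of
events determined by the two edges of a path (`both`, `none`, `onlyLo`, `onlyUp` and their Boolean
combinations), so its probability is a product of per-path cylinder probabilities
(`prob_iInter_paths`, from `Independence.prob_inter_eq_mul_of_dependsOn`).  `KTwoKRefutation`
evaluates these products on `K_{2,21}` at the uniform weight `1/2` and finds `(T_h)` VIOLATED.
No instance, no notation.
-/

namespace Summit.Ventures.PercRepro2

namespace KTwoK

open Finset

section Events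

variable {k : ℕ}

/-- The family `{x_i ∈ T for every i ∈ A}` of vertex sets (a principal up-set). -/
def hitFam (A : Finset (Fin k)) : Set (Set (Fin (k + 2))) := {T | ∀ i ∈ A, mid i ∈ T}

/-- `hitFam A` is an up-set. -/
lemma isUpperSet_hitFam (A : Finset (Fin k)) : IsUpperSet (hitFam A) :=
  fun _ _ hle hT i hi => hle (hT i hi)

/-- The hit event `Q = {h ∈ C_r}`. -/
def Q (k : ℕ) : Set (Config (Fin (2 * k))) :=
  clusterInEvent (ends k) 0 {T : Set (Fin (k + 2)) | (1 : Fin (k + 2)) ∈ T}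

/-- The event `U A = {C_r ∈ hitFam A} = {x_i ∈ C_r, i ∈ A}`. -/
def U (A : Finset (Fin k)) : Set (Config (Fin (2 * k))) := clusterInEvent (ends k) 0 (hitFam A)

/-- `Q` is the hit predicate. -/
lemma mem_Q_iff (ω : Config (Fin (2 * k))) : ω ∈ Q k ↔ Hit ω := by
  rw [Q, mem_clusterInEvent, Set.mem_setOf_eq, one_mem_iff]

/-- `U A` explicitly. -/
lemma mem_U_iff (A : Finset (Fin k)) (ω : Config (Fin (2 * k))) :
    ω ∈ U A ↔ ∀ i ∈ A, ω (lo i) = true ∨ (Hit ω ∧ ω (up i) = true) := by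
  rw [U, mem_clusterInEvent, hitFam, Set.mem_setOf_eq]
  exact forall₂_congr fun i _ => mid_mem_iff ω i

/-- `U A ∩ U B = U (A ∪ B)`. -/
lemma U_inter_U (A B : Finset (Fin k)) : U A ∩ U B = U (A ∪ B) := by
  ext ω
  simp only [Set.mem_inter_iff, mem_U_iff, Finset.mem_union]
  constructor
  · rintro ⟨hA, hB⟩ i hi
    exact hi.elim (hA i) (hB i)
  · intro h
    exact ⟨fun i hi => h i (Or.inl hi), fun i hi => h i (Or.inr hi)⟩

/-- Both edges of the path `i` open. -/
def both (i : Fin k) : Set (Config (Fin (2 * k))) := {ω | ω (lo i) = true ∧ ω (up i) = true}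

/-- Both edges of the path `i` closed. -/
def none (i : Fin k) : Set (Config (Fin (2 * k))) := {ω | ω (lo i) = false ∧ ω (up i) = false}

/-- Exactly the lower edge of the path `i` open. -/
def onlyLo (i : Fin k) : Set (Config (Fin (2 * k))) := {ω | ω (lo i) = true ∧ ω (up i) = false}

/-- Exactly the upper edge of the path `i` open. -/
def onlyUp (i : Fin k) : Set (Config (Fin (2 * k))) := {ω | ω (lo i) = false ∧ ω (up i) = true}

/-- `Qᶜ` is «no path fully open». -/
lemma compl_Q_eq : (Q k)ᶜ = ⋂ i, (both i)ᶜ := by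
  ext ω
  simp only [Set.mem_compl_iff, mem_Q_iff, Hit, Set.mem_iInter, both, Set.mem_setOf_eq, not_exists]

/-- On `Q`, `U A` is «every `A`-path has an open edge». -/
lemma Q_inter_U (A : Finset (Fin k)) :
    Q k ∩ U A = Q k ∩ ⋂ i, (if i ∈ A then (none i)ᶜ else Set.univ) := by
  ext ω
  simp only [Set.mem_inter_iff, mem_Q_iff, mem_U_iff, Set.mem_iInter]
  constructor
  · rintro ⟨hq, h⟩
    refine ⟨hq, fun i => ?_⟩
    split_ifs with hi
    · simp only [Set.mem_compl_iff, none, Set.mem_setOf_eq, not_and]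
      rcases h i hi with hlo | ⟨-, hup⟩
      · intro h'; rw [h'] at hlo; exact absurd hlo (by decide)
      · intro _ h'; rw [h'] at hup; exact absurd hup (by decide)
    · exact Set.mem_univ ω
  · rintro ⟨hq, h⟩
    refine ⟨hq, fun i hi => ?_⟩
    have hi' := h i
    rw [if_pos hi] at hi'
    simp only [Set.mem_compl_iff, none, Set.mem_setOf_eq, not_and] at hi'
    cases hlo : ω (lo i)
    · exact Or.inr ⟨hq, by simpa using hi' hlo⟩
    · exact Or.inl rfl

/-- On `Qᶜ`, `U A` is «every `A`-path has exactly its lower edge open». -/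
lemma compl_Q_inter_U (A : Finset (Fin k)) :
    (Q k)ᶜ ∩ U A = ⋂ i, (if i ∈ A then onlyLo i else (both i)ᶜ) := by
  ext ω
  simp only [Set.mem_inter_iff, Set.mem_compl_iff, mem_Q_iff, mem_U_iff, Set.mem_iInter]
  constructor
  · rintro ⟨hq, h⟩ i
    split_ifs with hi
    · rcases h i hi with hlo | ⟨hhit, -⟩
      · refine ⟨hlo, ?_⟩
        cases hup : ω (up i)
        · rfl
        · exact absurd ⟨i, hlo, hup⟩ hq
      · exact absurd hhit hq
    · simp only [Set.mem_compl_iff, both, Set.mem_setOf_eq]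
      exact fun hb => hq ⟨i, hb⟩
  · intro h
    have hq : ¬ Hit ω := by
      rintro ⟨i, hlo, hup⟩
      have hi := h i
      split_ifs at hi with hmem
      · exact absurd hup (by rw [hi.2]; decide)
      · exact hi ⟨hlo, hup⟩
    refine ⟨hq, fun i hi => ?_⟩
    have := h i
    rw [if_pos hi] at this
    exact Or.inl this.1

/-- «Every `A`-path has an open edge» and «no path fully open», as one intersection. -/
lemma compl_Q_inter_R (A : Finset (Fin k)) :
    (Q k)ᶜ ∩ (⋂ i, (if i ∈ A then (none i)ᶜ else Set.univ)) =
      ⋂ i, (if i ∈ A then onlyLo i ∪ onlyUp i else (both i)ᶜ) := by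
  rw [compl_Q_eq, ← Set.iInter_inter_distrib]
  refine Set.iInter_congr fun i => ?_
  ext ω
  split_ifs with hi
  · simp only [Set.mem_inter_iff, Set.mem_compl_iff, both, none, onlyLo, onlyUp, Set.mem_setOf_eq,
      Set.mem_union]
    cases ω (lo i) <;> cases ω (up i) <;> simp
  · simp

end Events

section Products

variable {k : ℕ} {R : Type*} [CommRing R]

/-- The two edges of the path `i`. -/
def pathEdges (i : Fin k) : Set (Fin (2 * k)) := {lo i, up i}

/-- The paths have disjoint edge sets. -/
lemma pathEdges_disjoint {i j : Fin k} (h : i ≠ j) : Disjoint (pathEdges i) (pathEdges j) := by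
  rw [Set.disjoint_left]
  intro e hi hj
  simp only [pathEdges, Set.mem_insert_iff, Set.mem_singleton_iff] at hi hj
  rcases hi with rfl | rfl <;> rcases hj with h' | h'
  · exact h (lo_injective h')
  · exact lo_ne_up _ _ h'
  · exact lo_ne_up _ _ h'.symm
  · exact h (up_injective h')

/-- An event given by a predicate on the two edge states of the path `i` is determined by `pathEdges i`. -/
lemma dependsOn_path (i : Fin k) (P : Bool → Bool → Prop) :
    DependsOn (· ∈ {ω : Config (Fin (2 * k)) | P (ω (lo i)) (ω (up i))}) (pathEdges i) := by
  intro ω ω' h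
  have h1 := h (lo i) (by simp [pathEdges])
  have h2 := h (up i) (by simp [pathEdges])
  show P (ω (lo i)) (ω (up i)) = P (ω' (lo i)) (ω' (up i))
  rw [h1, h2]

/-- An intersection of path-determined events is determined by the union of the path edges. -/
lemma dependsOn_biInter (S : Finset (Fin k)) (E : Fin k → Set (Config (Fin (2 * k))))
    (hE : ∀ i, DependsOn (· ∈ E i) (pathEdges i)) :
    DependsOn (· ∈ ⋂ i ∈ S, E i) (⋃ i ∈ S, pathEdges i) := by
  intro ω ω' h
  apply propext
  simp only [Set.mem_iInter]
  refine forall₂_congr fun i hi => dependsOn_mem_iff (hE i) fun e he => h e ?_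
  exact Set.mem_biUnion hi he

/-- **Probabilities multiply over the paths**: for events `E i` each determined by the two edges of
its path, `P(⋂ i ∈ S, E i) = ∏ i ∈ S, P(E i)`. -/
theorem prob_biInter_paths (p : Fin (2 * k) → R) (E : Fin k → Set (Config (Fin (2 * k))))
    (hE : ∀ i, DependsOn (· ∈ E i) (pathEdges i)) (S : Finset (Fin k)) :
    prob p (⋂ i ∈ S, E i) = ∏ i ∈ S, prob p (E i) := by
  induction S using Finset.induction_on with
  | empty => simp [prob_univ]
  | insert a S ha ih =>
    rw [Finset.set_biInter_insert, Finset.prod_insert ha, ← ih]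
    refine prob_inter_eq_mul_of_dependsOn p ?_ (hE a) (dependsOn_biInter S E hE)
    rw [Set.disjoint_left]
    intro e he he'
    obtain ⟨i, hi, hei⟩ := Set.mem_iUnion₂.1 he'
    exact Set.disjoint_left.1 (pathEdges_disjoint (fun h : a = i => ha (h ▸ hi))) he hei

/-- The same over all paths. -/
theorem prob_iInter_paths (p : Fin (2 * k) → R) (E : Fin k → Set (Config (Fin (2 * k))))
    (hE : ∀ i, DependsOn (· ∈ E i) (pathEdges i)) :
    prob p (⋂ i, E i) = ∏ i, prob p (E i) := by
  have h := prob_biInter_paths p E hE Finset.univ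
  simpa using h

/-- `lo i ≠ up i`. -/
lemma lo_ne_up_self (i : Fin k) : lo i ≠ up i := lo_ne_up i i

/-- `P(both edges of path i open) = p (lo i) · p (up i)`. -/
lemma prob_both (p : Fin (2 * k) → R) (i : Fin k) : prob p (both i) = p (lo i) * p (up i) := by
  have : both i = allOpen {lo i, up i} := by
    ext ω; simp [both, allOpen]
  rw [this, prob_allOpen, Finset.prod_pair (lo_ne_up_self i)]

/-- `P(both edges of path i closed) = (1 - p (lo i)) (1 - p (up i))`. -/
lemma prob_none (p : Fin (2 * k) → R) (i : Fin k) :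
    prob p (none i) = (1 - p (lo i)) * (1 - p (up i)) := by
  have : none i = allClosed {lo i, up i} := by
    ext ω; simp [none, allClosed]
  rw [this, prob_allClosed, Finset.prod_pair (lo_ne_up_self i)]

/-- `P(exactly the lower edge of path i open) = p (lo i) (1 - p (up i))`. -/
lemma prob_onlyLo (p : Fin (2 * k) → R) (i : Fin k) :
    prob p (onlyLo i) = p (lo i) * (1 - p (up i)) := by
  have : onlyLo i = cylinder {lo i, up i} fun e => decide (e = lo i) := by
    ext ω
    simp only [onlyLo, Set.mem_setOf_eq, mem_cylinder, Finset.forall_mem_insert, Finset.mem_singleton,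
      forall_eq]
    simp [(lo_ne_up_self i).symm]
  rw [this, prob_cylinder, Finset.prod_pair (lo_ne_up_self i)]
  simp [edgeFactor, (lo_ne_up_self i).symm]

/-- `P(exactly the upper edge of path i open) = (1 - p (lo i)) p (up i)`. -/
lemma prob_onlyUp (p : Fin (2 * k) → R) (i : Fin k) :
    prob p (onlyUp i) = (1 - p (lo i)) * p (up i) := by
  have : onlyUp i = cylinder {lo i, up i} fun e => decide (e = up i) := by
    ext ω
    simp only [onlyUp, Set.mem_setOf_eq, mem_cylinder, Finset.forall_mem_insert, Finset.mem_singleton,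
      forall_eq]
    simp [lo_ne_up_self i]
  rw [this, prob_cylinder, Finset.prod_pair (lo_ne_up_self i)]
  simp [edgeFactor, lo_ne_up_self i]

/-- `onlyLo` and `onlyUp` are disjoint. -/
lemma disjoint_onlyLo_onlyUp (i : Fin k) : Disjoint (onlyLo i) (onlyUp i) := by
  rw [Set.disjoint_left]
  rintro ω ⟨h1, -⟩ ⟨h2, -⟩
  rw [h1] at h2
  exact absurd h2 (by decide)

/-- `P(exactly one edge of path i open) = p (lo i) (1 - p (up i)) + (1 - p (lo i)) p (up i)`. -/
lemma prob_onlyLo_union_onlyUp (p : Fin (2 * k) → R) (i : Fin k) :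
    prob p (onlyLo i ∪ onlyUp i) = p (lo i) * (1 - p (up i)) + (1 - p (lo i)) * p (up i) := by
  rw [prob_union_of_disjoint p (disjoint_onlyLo_onlyUp i), prob_onlyLo, prob_onlyUp]

/-- The four path events and their Boolean combinations are determined by the path's edges. -/
lemma dependsOn_both (i : Fin k) : DependsOn (· ∈ both i) (pathEdges i) :=
  dependsOn_path i fun a b => a = true ∧ b = true

/-- `(both i)ᶜ` is determined by the path's edges. -/
lemma dependsOn_both_compl (i : Fin k) : DependsOn (· ∈ (both i)ᶜ) (pathEdges i) :=
  dependsOn_compl (dependsOn_both i)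

/-- `(none i)ᶜ` is determined by the path's edges. -/
lemma dependsOn_none_compl (i : Fin k) : DependsOn (· ∈ (none i)ᶜ) (pathEdges i) :=
  dependsOn_compl (dependsOn_path i fun a b => a = false ∧ b = false)

/-- `onlyLo i` is determined by the path's edges. -/
lemma dependsOn_onlyLo (i : Fin k) : DependsOn (· ∈ onlyLo i) (pathEdges i) :=
  dependsOn_path i fun a b => a = true ∧ b = false

/-- `onlyLo i ∪ onlyUp i` is determined by the path's edges. -/
lemma dependsOn_onlyLo_union_onlyUp (i : Fin k) :
    DependsOn (· ∈ onlyLo i ∪ onlyUp i) (pathEdges i) :=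
  dependsOn_path i fun a b => (a = true ∧ b = false) ∨ (a = false ∧ b = true)

/-- `Set.univ` is determined by anything. -/
lemma dependsOn_univ_path (i : Fin k) :
    DependsOn (· ∈ (Set.univ : Set (Config (Fin (2 * k))))) (pathEdges i) :=
  fun _ _ _ => rfl

end Products

end KTwoK

end Summit.Ventures.PercRepro2
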